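import Mathlib
import HarnessLib
import Summits.HubbardSuperconductivity.HubbardSuperconductivity.Theorems.KLProgrammeKLRegimeTwoVolumeLipJumpDefs
import Summits.HubbardSuperconductivity.HubbardSuperconductivity.Theorems.KLProgrammeKLRegimeTwoVolumeLipGlueTransferRows
import Summits.HubbardSuperconductivity.HubbardSuperconductivity.Theorems.KLProgrammeKLRegimeTwoVolumeSectorBlockShift

/-!
# Route `KLProgramme` — crux K3 ENGINE (stmt-HubbardSuperconductivity-20437), stub (e) proof-input «(e)-D-ROWS», G-1 AT THE MODEL: THE JUMP / BLOCK-TRANSFER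
# MATRICES THROUGH THE CANONICAL DOOR FROM E1's `klScaleWt`-WEIGHTED ROW AND COLUMN SUMS
# (seat hubbard-kl-k3c4-p1 g23; `--supports` 20437; DROWS-SCOPE-g23 v5 §9.4 G-1)

`…TwoVolumeLipGlueTransferRows.klGlue_transfer_le_of_wtRows` leaves three data of the fine transfer `T′`: Λ_T-scaled weighted rows / columns and block
covariance.  For the jump matrices `T′ = klJump (bL) M β μ K J′ J` (`…LipJumpDefs`; the block transfer `klLipTransfer … d k` is the case `(J′, J) = (dk, dk−1)`,
`klLipTransfer_eq_klJump`) block covariance under `klBlockEquiv` is k3c4-p1 g8's `…TwoVolumeSectorBlockShift.norm_sectorOverlap_blockCovariant` (as route A's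
`norm_klReanalysis_blockCovariant`), the periodisation is `klJump_periodise`, and the Λ_T-scaled weight is dominated by E1's tree weight `klScaleWt (bL) M β j_r`
of any rate `j_r` with `Λ_T ≤ Λ_{j_r}` (`…TwoVolumeDataKitWt.one_add_mul_tnorm_le_klScaleWt_pair`) — so the rows are read in E1's currency (the pair-weighted
row / column sums of `‖E(F_{J′})·S(F̃_J)‖`, `TorusFourierL2.overlapWt_jump_sums_klEng_flow_deep` conjuncts 2–3, `…EngineTowerRemeasureWt`).

* `norm_klJump_blockCovariant` — block covariance of `klJump (bL)` under the canonical structures.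
* `klJump_transfer_le_of_scaleWtRows` — the canonical transfer door for `(klJump (bL), klJump L)` with periodisation, covariance, the nine rows and the triangle
  DISCHARGED; named: the two `klScaleWt`-weighted sums (`≤ cW`, rate `j_r`, `0 ≤ Λ_T ≤ Λ_{j_r}`), the coarse profiles `N`, `N_far`, the defect profiles `E`, `ND`.

Compositions of landed theorems; nothing asserts the (D) rows, stub (e), VL, K3 or superconductivity.
References: BGM 2006 §2.7 (2.71), §3 (3.2)–(3.8) [cite: BenfattoGiulianiMastropietro2006].
-/

namespace Summit.HubbardSuperconductivity.HubbardSuperconductivity.Theorems.TwoVolumeLip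

set_option linter.dupNamespace false -- summit = problem name (single-conjunct summit), D-0017

open Finset Literature.MathematicalPhysics.QuantumLattice GrassmannAlgebra Literature.Probability.LatticeModels
open Literature.MathematicalPhysics.QuantumLattice.FermiRG
open Summit.HubbardSuperconductivity.HubbardSuperconductivity.Theorems.KLRegimeSplit
open Summit.HubbardSuperconductivity.HubbardSuperconductivity.Theorems.KLProgrammeLegKernels
open Summit.HubbardSuperconductivity.HubbardSuperconductivity.Theorems.DispersionFlow
open Summit.HubbardSuperconductivity.HubbardSuperconductivity.Theorems.EngineV8
open Summit.HubbardSuperconductivity.HubbardSuperconductivity.Theorems.TwoVolumeSource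
open Summit.HubbardSuperconductivity.HubbardSuperconductivity.Theorems.TwoVolumeDefect
open Summit.HubbardSuperconductivity.HubbardSuperconductivity.Theorems.TwoPointAssembly

noncomputable section

variable {L b M : ℕ} [NeZero L] [NeZero (b * L)] [NeZero M]

/-- **Block covariance of the jump matrix** `klJump (bL) M β μ K J′ J` under the canonical block structures (`klJump_eq_smul` + k3c4-p1 g8's
`norm_sectorOverlap_blockCovariant` at `klBlockEquiv_val / _snd`; route A's `norm_klReanalysis_blockCovariant` is the case `J′ = J + 1`). -/
theorem norm_klJump_blockCovariant {β : ℝ} (hβ : β ≠ 0) (μ : ℝ) (K : TrigPolyC4v) (J' J : ℕ) (δ B' B₁ : Fin 2 → Fin b)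
    (xbar : SpaceTimeIdx L M × SectorLeg (sectorCount J')) (y : SpaceTimeIdx L M × SectorLeg (sectorCount J)) :
    ‖klJump (b * L) M β μ K J' J ((klBlockEquiv L b M (sectorCount J')).symm (B' + δ, xbar)) ((klBlockEquiv L b M (sectorCount J)).symm (B₁ + δ, y))‖ =
      ‖klJump (b * L) M β μ K J' J ((klBlockEquiv L b M (sectorCount J')).symm (B', xbar)) ((klBlockEquiv L b M (sectorCount J)).symm (B₁, y))‖ := by
  rw [klJump_eq_smul, Matrix.smul_apply, Matrix.smul_apply, smul_eq_mul, smul_eq_mul, norm_mul, norm_mul,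
    norm_sectorOverlap_blockCovariant (b := b) (L := L) (Lf := b * L) rfl hβ _ _ (klBlockEquiv L b M (sectorCount J'))
      (klBlockEquiv_val L b M (sectorCount J')) (klBlockEquiv_snd L b M (sectorCount J')) (klBlockEquiv L b M (sectorCount J))
      (klBlockEquiv_val L b M (sectorCount J)) (klBlockEquiv_snd L b M (sectorCount J)) δ B' B₁ xbar y]

set_option maxHeartbeats 400000 in -- one large door application
/-- **G-1 at the model — the jump / block-transfer matrices through the canonical door, rows in E1's currency.**  For `T′, T := klJump (bL), klJump L` at
`(J′, J)`, a `(D₀ + r)`-deep output pin `w′` (`2r ≤ D₀`), `0 < β`, a rate `j_r` with `0 ≤ Λ_T ≤ Λ_{j_r}`, and `klScaleWt (bL) M β j_r`-weighted row and column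
sums of `klJump (bL)` at most `cW`: the bound of `klGlue_transfer_le_of_wtRows` (`a := cW`, `τ := cW/(1 + Λ_T(r+1))`) for ANY fine `W′` and coarse `W` —
periodisation (`klJump_periodise`), block covariance (`norm_klJump_blockCovariant`), the nine rows and the triangle discharged. -/
theorem klJump_transfer_le_of_scaleWtRows {β : ℝ} (hβ : 0 < β) (μ : ℝ) (K : TrigPolyC4v) (J' J jr : ℕ)
    {ΛT cW : ℝ} (hΛT : 0 ≤ ΛT) (hΛr : ΛT ≤ klScale klE0 jr) (hcW : 0 ≤ cW)
    (hrow : ∀ x, ∑ y', ‖klJump (b * L) M β μ K J' J x y'‖ *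
      klScaleWt (b * L) M β jr {latticeLegPos (2 * (2 * M)) x, latticeLegPos (2 * (2 * M)) y'} ≤ cW)
    (hcol : ∀ y', ∑ x, ‖klJump (b * L) M β μ K J' J x y'‖ *
      klScaleWt (b * L) M β jr {latticeLegPos (2 * (2 * M)) x, latticeLegPos (2 * (2 * M)) y'} ≤ cW)
    (W' : GrassmannAlgebra ℂ (SpaceTimeIdx (b * L) M × SectorLeg (sectorCount J))) (W : GrassmannAlgebra ℂ (SpaceTimeIdx L M × SectorLeg (sectorCount J)))
    {n : ℕ} (p : Fin (n + 1)) (w' : SpaceTimeIdx (b * L) M × SectorLeg (sectorCount J')) (D₀ r : ℕ) (hD₀ : 2 * r ≤ D₀)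
    (hw : ∀ i, D₀ + r ≤ (w'.1.2 i).val % L ∧ (w'.1.2 i).val % L + (D₀ + r) < L)
    {N Nfar E ND : ℝ} (hN0 : 0 ≤ N) (hNfar0 : 0 ≤ Nfar) (hE0 : 0 ≤ E) (hND0 : 0 ≤ ND)
    (hN : ∀ y, ∑ Y ∈ univ.filter (fun Y : Fin (n + 1) → SpaceTimeIdx L M × SectorLeg (sectorCount J) => Y p = y), ‖kernel ℂ W (n + 1) Y‖ ≤ N)
    (hNfar : ∀ y (i : Fin (n + 1)),
      ∑ Y ∈ univ.filter (fun Y : Fin (n + 1) → SpaceTimeIdx L M × SectorLeg (sectorCount J) => Y p = y ∧ r < Torus.tnorm ((Y p).1.2 - (Y i).1.2)),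
        ‖kernel ℂ W (n + 1) Y‖ ≤ Nfar)
    (hE : ∀ y' : SpaceTimeIdx (b * L) M × SectorLeg (sectorCount J), Torus.tnorm (w'.1.2 - y'.1.2) ≤ r →
      ∑ Y' ∈ univ.filter (fun Y' : Fin (n + 1) → SpaceTimeIdx (b * L) M × SectorLeg (sectorCount J) => Y' p = y'),
        ‖kernel ℂ (W' - klGlue L b M (sectorCount J) W) (n + 1) Y'‖ ≤ E)
    (hND : ∀ y', ∑ Y' ∈ univ.filter (fun Y' : Fin (n + 1) → SpaceTimeIdx (b * L) M × SectorLeg (sectorCount J) => Y' p = y'),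
      ‖kernel ℂ (W' - klGlue L b M (sectorCount J) W) (n + 1) Y'‖ ≤ ND) :
    ∑ X' ∈ univ.filter (fun X' : Fin (n + 1) → SpaceTimeIdx (b * L) M × SectorLeg (sectorCount J') => X' p = w'),
        ‖kernel ℂ (ExteriorAlgebra.map (Matrix.toLin' (klJump (b * L) M β μ K J' J)) W' -
            klGlue L b M (sectorCount J') (ExteriorAlgebra.map (Matrix.toLin' (klJump L M β μ K J' J)) W)) (n + 1) X'‖ ≤
      cW ^ n * (cW * E + cW / (1 + ΛT * ((r : ℝ) + 1)) * ND) +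
        (2 * cW ^ n * (cW / (1 + ΛT * ((r : ℝ) + 1))) * N + n * cW ^ n * (5 * (cW / (1 + ΛT * ((r : ℝ) + 1))) * N + 2 * cW * Nfar)) := by
  have hβ0 : β ≠ 0 := hβ.ne'
  have hrow' : ∀ x : SpaceTimeIdx (b * L) M × SectorLeg (sectorCount J'),
      ∑ y', ‖klJump (b * L) M β μ K J' J x y'‖ * (1 + ΛT * (Torus.tnorm (x.1.2 - y'.1.2) : ℝ)) ≤ cW := fun x => by
    refine (sum_le_sum fun y' _ => ?_).trans (hrow x)
    exact mul_le_mul_of_nonneg_left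
      (one_add_mul_tnorm_le_klScaleWt_pair hβ.le hΛr ((x.1, y'.2) : SpaceTimeIdx (b * L) M × SectorLeg (sectorCount J)) y') (norm_nonneg _)
  have hcol' : ∀ y' : SpaceTimeIdx (b * L) M × SectorLeg (sectorCount J),
      ∑ x, ‖klJump (b * L) M β μ K J' J x y'‖ * (1 + ΛT * (Torus.tnorm (x.1.2 - y'.1.2) : ℝ)) ≤ cW := fun y' => by
    refine (sum_le_sum fun x _ => ?_).trans (hcol y')
    exact mul_le_mul_of_nonneg_left
      (one_add_mul_tnorm_le_klScaleWt_pair hβ.le hΛr ((x.1, y'.2) : SpaceTimeIdx (b * L) M × SectorLeg (sectorCount J)) y') (norm_nonneg _)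
  exact klGlue_transfer_le_of_wtRows (klJump (b * L) M β μ K J' J) (klJump L M β μ K J' J) (fun X' Y => klJump_periodise hβ0 μ K J' J X' Y)
    hΛT hcW hrow' hcol' (fun δ B' B xbar y => norm_klJump_blockCovariant hβ0 μ K J' J δ B' B xbar y) W' W p w' D₀ r hD₀ hw hN0 hNfar0 hE0 hND0
    hN hNfar hE hND

end

end Summit.HubbardSuperconductivity.HubbardSuperconductivity.Theorems.TwoVolumeLip
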